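import Mathlib
import HarnessLib

/-!
# Line `action_creep` (ns-idea-11 g8): a finite action budget forces HOVERING off a small time set (Chebyshev along the filament)
# (crux `EulerZoomLiouville.PowerGaugeEulerLiouville` = stmt-NavierStokesRegularity-19832; class-free real-analysis lemma; width seat ns-ezl-w3 g6)

Route №10 `EulerZoomLiouville`, crux E.  Companion of AC1′ `ActionCreep.creepingFilament` (p683438): a creeping filament `Y` has action `∫₀^T ‖W(Y t)‖² dt ≤ δ`
for every `T`; hence (`ActionCreep.volume_speed_ge_le_of_action`) for every `η > 0` the set of times `t ∈ [0, T]` at which it is NOT `η`-hovering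
(`‖W(Y t)‖ ≥ η`) has Lebesgue measure `≤ δ/η²` — uniformly in `T` — the quantitative «creeping» of the line's card (REV2, AC2′ informal content).
Stated for any continuous speed function `g ≥ 0` on `[0, T]`.

WHAT THIS IS NOT: not NS regularity, not the crux E — a Chebyshev bookkeeping lemma (MODEL lattice), `--supports` stmt-19832; 19832 OPEN. [folklore]
-/

noncomputable section

set_option linter.dupNamespace false

open Set MeasureTheory
open scoped ENNReal

namespace Summit.NavierStokesRegularity.NavierStokesRegularity.Theorems.PowerGaugeEulerLiouville

namespace ActionCreep

/-- **Chebyshev along a filament**: if `g` is continuous on `[0, T]` with `∫₀^T g² ≤ δ` and `η > 0`, then the times `t ∈ [0,T]` with `η ≤ g t` have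
measure `≤ δ/η²`. [folklore] -/
theorem volume_speed_ge_le_of_action {g : ℝ → ℝ} {T δ η : ℝ} (hT : 0 ≤ T) (hg : ContinuousOn g (Icc 0 T)) (hη : 0 < η)
    (hact : ∫ t in (0 : ℝ)..T, g t ^ 2 ≤ δ) :
    (volume {t : ℝ | t ∈ Icc 0 T ∧ η ≤ g t}).toReal ≤ δ / η ^ 2 := by
  set S : Set ℝ := {t : ℝ | t ∈ Icc 0 T ∧ η ≤ g t} with hS
  have hSsub : S ⊆ Icc 0 T := fun t ht => ht.1
  have hSclosed : IsClosed S := by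
    have e : S = Icc 0 T ∩ g ⁻¹' Ici η := by ext t; simp [hS, and_assoc]
    rw [e]
    exact hg.preimage_isClosed_of_isClosed isClosed_Icc isClosed_Ici
  have hSm : MeasurableSet S := hSclosed.measurableSet
  have hSfin : volume S < ⊤ := (measure_mono hSsub).trans_lt (by rw [Real.volume_Icc]; exact ENNReal.ofReal_lt_top)
  have hg2i : IntegrableOn (fun t => g t ^ 2) (Icc 0 T) volume :=
    (hg.pow 2).integrableOn_compact isCompact_Icc
  -- `η² · vol S ≤ ∫_S g² ≤ ∫_{[0,T]} g² = ∫₀^T g² ≤ δ`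
  have h1 : η ^ 2 * (volume S).toReal = ∫ _ in S, η ^ 2 := by
    rw [setIntegral_const, smul_eq_mul, mul_comm]; rfl
  have h2 : ∫ _ in S, η ^ 2 ≤ ∫ t in S, g t ^ 2 := by
    refine setIntegral_mono_on (integrableOn_const hSfin.ne) (hg2i.mono_set hSsub) hSm fun t ht => ?_
    have := ht.2
    exact pow_le_pow_left₀ hη.le this 2
  have h3 : ∫ t in S, g t ^ 2 ≤ ∫ t in Icc 0 T, g t ^ 2 :=
    setIntegral_mono_set hg2i (Filter.Eventually.of_forall fun t => sq_nonneg _) (Filter.Eventually.of_forall hSsub)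
  have h4 : ∫ t in Icc 0 T, g t ^ 2 = ∫ t in (0 : ℝ)..T, g t ^ 2 := by
    rw [intervalIntegral.integral_of_le hT, integral_Icc_eq_integral_Ioc]
  have hη2 : 0 < η ^ 2 := by positivity
  rw [le_div_iff₀ hη2, mul_comm]
  linarith

end ActionCreep

end Summit.NavierStokesRegularity.NavierStokesRegularity.Theorems.PowerGaugeEulerLiouville

end
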